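/-
Copyright (c) 2026 the pub-hodgecm-mathlib formalisation cell (harness21).  Prover seat hodgecm-mathlib-F0P3-p02 (g27), 2026-09-03.  E1 row 57 «(J)-JUNCTION: THE SCHNEIDER–STUHLER
CHAIN SPACES ARE DIRECT SUMS OF COMPACT INDUCTIONS», FILE A (generic; E1 keeper ∕ dealer F0P3a-p03 (g30) 03:21:28Z ∕ 03:26:31Z «= ×7»; census `CENSUS-R57-chains-cInd.v1` eaa3b19d).
-/
import Literature.NumberTheory.Automorphic.CompactInductionDirectSumFrobenius   -- ★ 45 (F0P2-p01): `exists_linearEquiv_intertwiningMap_directSum_pi`, `finrank_intertwiningMap_directSum_cIndRep_eq_sum`; brings ★ C-IND FROBENIUS + ★ `SmoothInduction`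
import HarnessLib

/-!
# A block-permutation module is the direct sum of the compact inductions of its representative blocks

Topic `NumberTheory/Automorphic` (next to ★ `SmoothInduction` ∕ ★ C-IND FROBENIUS `CompactInductionFrobenius` ∕ ★ 45 `CompactInductionDirectSumFrobenius`); declarations in the
`Representation` namespace.  THEOREMS ONLY (no definition, no instance, no notation, no named fact, no `sorry`).  Cell `pub/hodgecm-mathlib` (D-0151), crux H413 =
`stmt-HodgeConjecture-24833`, lane `--supports`; E1 BRICK LEDGER row 57 FILE A (the generic half of the junction «`C_q(X;V) ≅ ⊕_{F ∈ Γ∖X_q} c-Ind_{P_F}^Γ V^{U_F}`»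
[SchneiderStuhler1997, Ch. II §2–§3, Ch. III §4] between ★ 5a's global chain modules and ★ 45's abstract `C_q := ⨁ᵢ c-Ind_{Pᵢ}^G τᵢ`).  HONEST LABEL: count-neutral generic base layer;
(R-SS) banked PAYDOWN-UNR for K1 only; E1 = PRINT until the keeper's charter test; HC_CM is proved only modulo the printed citations until rung 0 closes.

THE MATHEMATICS ([Brown1982, III §5 (5.3)–(5.4)]: a `G`-module that is a direct sum of subgroups permuted TRANSITIVELY by `G` is the module induced from the stabiliser of one
summand; [BushnellHenniart2006, §2.5]; [SchneiderStuhler1997, Ch. II §2]).  Let `ρ` be a representation of a topological group `G` on `M = ⊕_{b ∈ β} W_b` (INTERNAL direct sum of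
`k`-submodules `Blk b`), PERMUTED along an action `act` of `G` on `β`: `ρ(g) W_b ⊆ W_{g·b}` (the letters `h hact hact1 hperm` of ★ 47c FILE 1 `CoinvariantsBlockPermutation`).
ORBIT DATA: representatives `x : ι → β` of the orbits, the orbit index `idx : β → ι` (`idx (x i) = i`, `idx (g·b) = idx b`) and TRANSPORTERS `tr : β → G`, `tr b · x (idx b) = b`.
STABILISERS `P i = Stab_G(x i)`, assumed OPEN.  BLOCK CHARTS: the representative block `W_{x i}` is presented by an injective `j i : W i →ₗ M` with range `Blk (x i)` carrying a
SMOOTH representation `σ i` of `P i` with `j i (σ i p w) = ρ(p) (j i w)` (at the Schneider–Stuhler datum: `W i = V^{U_{x_i}}`, `j i = [x_i ↦ ·]`).  THEN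
  **`M ≅ ⊕_i c-Ind_{P i}^G σ i`** as `G`-representations (`exists_equiv_directSum_cIndRep`),
the equivalence sending the unit vector `f_w = 𝟙_{P_i}·σ_i(·) w ∈ c-Ind σ_i` to `j i w` (hence `y • f_w ↦ ρ(y) j i w`), with inverse `m ↦ (g ↦ j_i⁻¹ pr_{x_i}(ρ(g) m))_i`.
PROOF.  Summand by summand the map is the EXTENSION `T_{j_i}` of the `P_i`-map `j_i : σ_i → ρ|_{P_i}` (★ C-IND FROBENIUS §3); it is SURJECTIVE because every block is hit
(`m ∈ W_b`: `T (tr b • f_w) = ρ(tr b) j w = m` for `j w = ρ(tr b)⁻¹ m ∈ W_{x (idx b)}`), and INJECTIVE by the COEFFICIENT IDENTITY `j_i (c_i(g)) = pr_{x_i}(ρ(g) T c)` — linear in `c`,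
checked on the generators `y • f_w` (★ GENERATION `exists_finset_eq_sum_cIndRep_indicator`): `pr_{x_i}(ρ(g y) j_{i′} w) ≠ 0` forces `(g y)·x_{i′} = x_i`, i.e. `i′ = i` and
`g y ∈ P_i`, where both sides equal `ρ(g y) j_i w`.  No finiteness of `β`, `ι`, the orbits or `G` is used; `k` is any commutative ring (a field only in §4).

* §1 ONE CHART: `isSmooth_of_chart` (a chart of a smooth `ρ` is smooth); `exists_unitVector_linearMap` (the unit vectors `w ↦ f_w` as a LINEAR map `W →ₗ c-Ind_H σ`, ★ §1
  `exists_cInd_indicator`), `cIndRep_unitVector` (`p • f_w = f_{σ(p) w}`), `eq_unitVector_of_forall_toFun_eq_zero` (an `H`-supported vector is `f_{F(1)}`),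
  `exists_intertwiningMap_cIndRep_of_chart` (the summand map `T_j`, `T_j F = j (F 1)` on `H`-supported `F`, `T_j (y • f_w) = ρ(y) (j w)`).
* §2 THE HEART `exists_equiv_directSum_cIndRep` (with the value on unit vectors AND the coefficient identity for the inverse).
* §3 `nonempty_intertwiningMap_linearEquiv_of_blocks` : `Hom_G(M, π) ≃ₗ Hom_G(⊕_i c-Ind σ_i, π)` (pre-composition; any commutative ring `k`).
* §4 (`k` a field, `ι` finite) **`finrank k Hom_G(M, π) = Σ_i finrank k Hom_{P_i}(σ_i, π|_{P_i})`** (`finrank_intertwiningMap_eq_sum_of_blocks`, ★ 45 §3) — the right-hand side of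
  ★ 42 `smoothTrace_epFunction` BY SHAPE.
Consumer: FILE B `SchneiderStuhlerChainsCompactInduction` (instantiation at ★ 5a `C₀(X)`, `C₁(X)`), then K2′∕K4′ via ★ (J) `finrank_intertwiningMap_presentation`.

## References
* [Brown1982] K. S. Brown, *Cohomology of Groups*, GTM 87 (1982): III §5 (induced modules; Prop. (5.3)–(5.4): a direct sum of subgroups permuted transitively is induced from a stabiliser).
* [BushnellHenniart2006] C. J. Bushnell, G. Henniart, *The local Langlands conjecture for GL(2)* (2006): §2.5 (compact induction from an open subgroup; the functions `f_w`).
* [SchneiderStuhler1997] P. Schneider, U. Stuhler, *Representation theory and sheaves on the Bruhat–Tits building*, Publ. Math. IHÉS 85 (1997): Ch. II §2–§3 (the chain spaces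
  `C_q^{or}(X_{(e)}; γ_e(V)) = ⊕_{F} c-Ind_{P_F^†}^G V^{U_F^{(e)}}`), Ch. III §4.
* [BernsteinZelevinsky1976] I. N. Bernstein, A. V. Zelevinsky, *Representations of the group GL(n, F) where F is a non-archimedean local field*, Russian Math. Surveys 31 (1976): §2.22–2.23.
-/

set_option autoImplicit false

open scoped BigOperators DirectSum
open Function Literature.NumberTheory.Automorphic

namespace Representation

/-! ## §1 One chart: smoothness, unit vectors, the summand map -/

section Chart

variable {k G M W : Type*} [CommRing k] [Group G] [TopologicalSpace G] [IsTopologicalGroup G]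
  [AddCommGroup M] [Module k M] [AddCommGroup W] [Module k W]
  {ρ : Representation k G M} {H : Subgroup G} {σ : Representation k H W}

omit [IsTopologicalGroup G] in
/-- **A CHART OF A SMOOTH REPRESENTATION IS SMOOTH**: if `j : W → M` is injective with `j (σ p w) = ρ(p) (j w)`, the stabiliser of `w` in `H` is the trace of the (open) stabiliser
of `j w` in `G`. [cite: BernsteinZelevinsky1976, §2.22] -/
theorem isSmooth_of_chart (hρ : ρ.IsSmooth) {j : W →ₗ[k] M} (hjinj : Injective j) (hjσ : ∀ (p : H) (w : W), j (σ p w) = ρ (p : G) (j w)) : σ.IsSmooth := by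
  intro w
  have hset : (σ.stabilizerSubgroup w : Set H) = Subtype.val ⁻¹' (ρ.stabilizerSubgroup (j w) : Set G) := by
    ext p
    simp only [SetLike.mem_coe, mem_stabilizerSubgroup, Set.mem_preimage]
    refine ⟨fun hp => by rw [← hjσ, hp], fun hp => hjinj (by rw [hjσ, hp])⟩
  rw [isSmoothVector_iff, hset]
  exact (hρ (j w)).preimage continuous_subtype_val

variable (H σ) in
/-- **THE UNIT VECTORS AS A LINEAR MAP.**  For `H` OPEN and `σ` SMOOTH there is a `k`-linear `u : W → c-Ind_H^G σ` with `(u w)(x) = σ(x) w` on `H` and `= 0` off `H` (★ §1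
`exists_cInd_indicator` vector by vector; linearity because two compactly induced vectors with the same underlying function are equal). [cite: BushnellHenniart2006, §2.5 Proposition] -/
theorem exists_unitVector_linearMap (hH : IsOpen (H : Set G)) (hσ : σ.IsSmooth) :
    ∃ u : W →ₗ[k] CInd H σ, (∀ (w : W) (x : G) (hx : x ∈ H), (cIndToSmoothInd H σ (u w)).toFun x = σ ⟨x, hx⟩ w) ∧
      ∀ (w : W) (x : G), x ∉ H → (cIndToSmoothInd H σ (u w)).toFun x = 0 := by
  classical
  choose u hu hu0 using fun w : W => exists_cInd_indicator H σ hH (hσ w)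
  have hval : ∀ (w : W) (x : G), (cIndToSmoothInd H σ (u w)).toFun x = if hx : x ∈ H then σ ⟨x, hx⟩ w else 0 := by
    intro w x
    by_cases hx : x ∈ H
    · rw [dif_pos hx, hu w x hx]
    · rw [dif_neg hx, hu0 w x hx]
  refine ⟨{ toFun := u, map_add' := fun w w' => ?_, map_smul' := fun c w => ?_ }, fun w x hx => hu w x hx, fun w x hx => hu0 w x hx⟩
  · apply cIndToSmoothInd_injective
    rw [map_add]
    refine SmoothInd.ext (funext fun x => ?_)
    rw [SmoothInd.toFun_add, Pi.add_apply, hval, hval, hval]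
    split_ifs with hx
    · rw [map_add]
    · rw [add_zero]
  · apply cIndToSmoothInd_injective
    rw [map_smul]
    refine SmoothInd.ext (funext fun x => ?_)
    rw [SmoothInd.toFun_smul, Pi.smul_apply, hval, hval, RingHom.id_apply]
    split_ifs with hx
    · rw [map_smul]
    · rw [smul_zero]

/-- **`p • f_w = f_{σ(p) w}`** for `p ∈ H`: both sides are `x ↦ σ(x p) w` on `H`, `0` off `H`. [cite: BushnellHenniart2006, §2.5 Proposition] -/
theorem cIndRep_unitVector {u : W →ₗ[k] CInd H σ} (hu : ∀ (w : W) (x : G) (hx : x ∈ H), (cIndToSmoothInd H σ (u w)).toFun x = σ ⟨x, hx⟩ w)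
    (hu0 : ∀ (w : W) (x : G), x ∉ H → (cIndToSmoothInd H σ (u w)).toFun x = 0) (p : H) (w : W) :
    cIndRep H σ (p : G) (u w) = u (σ p w) := by
  apply cIndToSmoothInd_injective
  refine SmoothInd.ext (funext fun x => ?_)
  rw [toFun_cIndToSmoothInd_cIndRep]
  by_cases hx : x ∈ H
  · have hxp : x * (p : G) ∈ H := H.mul_mem hx p.2
    have hmk : (⟨x * (p : G), hxp⟩ : H) = ⟨x, hx⟩ * p := rfl
    rw [hu w _ hxp, hu _ x hx, ← Module.End.mul_apply, ← map_mul, hmk]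
  · have hxp : x * (p : G) ∉ H := fun h => hx (by simpa only [mul_inv_cancel_right] using H.mul_mem h (H.inv_mem p.2))
    rw [hu0 w _ hxp, hu0 _ x hx]

/-- **AN `H`-SUPPORTED VECTOR IS THE UNIT VECTOR OF ITS VALUE AT `1`**: `F = f_{F(1)}` (`F (x) = F (x · 1) = σ(x) F(1)` on `H`). [cite: BushnellHenniart2006, §2.5 Proposition] -/
theorem eq_unitVector_of_forall_toFun_eq_zero {u : W →ₗ[k] CInd H σ} (hu : ∀ (w : W) (x : G) (hx : x ∈ H), (cIndToSmoothInd H σ (u w)).toFun x = σ ⟨x, hx⟩ w)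
    (hu0 : ∀ (w : W) (x : G), x ∉ H → (cIndToSmoothInd H σ (u w)).toFun x = 0) (F : CInd H σ)
    (hF : ∀ x : G, x ∉ H → (cIndToSmoothInd H σ F).toFun x = 0) :
    F = u ((cIndToSmoothInd H σ F).toFun 1) := by
  apply cIndToSmoothInd_injective
  refine SmoothInd.ext (funext fun x => ?_)
  by_cases hx : x ∈ H
  · rw [hu _ x hx]
    have h := (cIndToSmoothInd H σ F).toFun_subgroup_mul ⟨x, hx⟩ 1
    rwa [mul_one] at h
  · rw [hF x hx, hu0 _ x hx]

/-- The value of a unit vector at `1` is `w`. [cite: BushnellHenniart2006, §2.5 Proposition] -/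
theorem toFun_unitVector_one {u : W →ₗ[k] CInd H σ} (hu : ∀ (w : W) (x : G) (hx : x ∈ H), (cIndToSmoothInd H σ (u w)).toFun x = σ ⟨x, hx⟩ w) (w : W) :
    (cIndToSmoothInd H σ (u w)).toFun 1 = w := by
  rw [hu w 1 H.one_mem]
  exact LinearMap.congr_fun (show σ ⟨1, H.one_mem⟩ = 1 from map_one σ) w

variable (H σ) in
/-- **THE SUMMAND MAP OF A CHART.**  For `H` OPEN and a linear `j : W → M` with `j (σ p w) = ρ(p) (j w)` (a `H`-map `σ → ρ|_H`) there is a `G`-map `T_j : c-Ind_H^G σ → ρ` with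
`T_j F = j (F 1)` for every `H`-supported `F` (★ C-IND FROBENIUS §3 EXTENSION `T_φ F = Σ_{xH} ρ(x) φ(F(x⁻¹))`). [cite: BushnellHenniart2006, §2.5 Proposition] [cite: Brown1982, III §5] -/
theorem exists_intertwiningMap_cIndRep_of_chart (hH : IsOpen (H : Set G)) (j : W →ₗ[k] M) (hjσ : ∀ (p : H) (w : W), j (σ p w) = ρ (p : G) (j w)) :
    ∃ T : (cIndRep H σ).IntertwiningMap ρ,
      ∀ F : CInd H σ, (∀ x : G, x ∉ H → (cIndToSmoothInd H σ F).toFun x = 0) → T F = j ((cIndToSmoothInd H σ F).toFun 1) := by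
  let φ : σ.IntertwiningMap (ρ.comp H.subtype) := ⟨j, fun p => LinearMap.ext fun w => hjσ p w⟩
  obtain ⟨T, hT⟩ := exists_intertwiningMap_cIndRep_extends H σ ρ hH φ
  exact ⟨T, fun F hF => hT F hF⟩

/-- **THE SUMMAND MAP ON TRANSLATES OF UNIT VECTORS: `T_j (y • f_w) = ρ(y) (j w)`.** [cite: BushnellHenniart2006, §2.5 Proposition] [cite: Brown1982, III §5] -/
theorem intertwiningMap_cIndRep_unitVector {u : W →ₗ[k] CInd H σ} (hu : ∀ (w : W) (x : G) (hx : x ∈ H), (cIndToSmoothInd H σ (u w)).toFun x = σ ⟨x, hx⟩ w)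
    (hu0 : ∀ (w : W) (x : G), x ∉ H → (cIndToSmoothInd H σ (u w)).toFun x = 0) {j : W →ₗ[k] M} {T : (cIndRep H σ).IntertwiningMap ρ}
    (hT : ∀ F : CInd H σ, (∀ x : G, x ∉ H → (cIndToSmoothInd H σ F).toFun x = 0) → T F = j ((cIndToSmoothInd H σ F).toFun 1)) (y : G) (w : W) :
    T (cIndRep H σ y (u w)) = ρ y (j w) := by
  rw [T.isIntertwining, hT (u w) (hu0 w), toFun_unitVector_one hu]

end Chart

/-! ## §2 The heart: `M ≅ ⊕_i c-Ind_{P_i}^G σ_i` -/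

section Blocks

variable {k G M : Type*} [CommRing k] [Group G] [TopologicalSpace G] [IsTopologicalGroup G] [AddCommGroup M] [Module k M]
  {ρ : Representation k G M} {β : Type*} {Blk : β → Submodule k M} {act : G → β → β}
  {ι : Type*} {W : ι → Type*} [∀ i, AddCommGroup (W i)] [∀ i, Module k (W i)]
  {P : ι → Subgroup G} {σ : ∀ i, Representation k (P i) (W i)} {j : ∀ i, W i →ₗ[k] M}

/-- **A BLOCK-PERMUTATION MODULE IS THE DIRECT SUM OF THE COMPACT INDUCTIONS OF ITS REPRESENTATIVE BLOCKS.**  For `M = ⊕_b W_b` internal, permuted along the action `act`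
(`ρ(g) W_b ⊆ W_{g·b}`), orbit data `x idx tr` (`idx (x i) = i`, `idx (g·b) = idx b`, `tr b · x (idx b) = b`), OPEN stabilisers `P i = Stab(x i)` and block charts
`j i : (W i, σ i) ≅ W_{x i}` (`σ i` smooth, `j i (σ i p w) = ρ(p) j i w`):  there is an equivalence of `G`-representations
**`e : ⊕_i c-Ind_{P i}^G σ i ≃ M`** with (i) `e ([F]_i) = j i (F 1)` for every `P i`-supported `F ∈ c-Ind σ i` (so `e ([y • f_w]_i) = ρ(y) j i w`), and (ii) the COEFFICIENT
IDENTITY for the inverse: `j i ((e⁻¹ m)_i (g)) = pr_{x i} (ρ(g) m)` (block component in the internal direct sum). [cite: Brown1982, III §5] [cite: SchneiderStuhler1997, Ch. II §2–§3]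
[cite: BushnellHenniart2006, §2.5 Proposition] -/
theorem exists_equiv_directSum_cIndRep [DecidableEq ι] [DecidableEq β] (h : DirectSum.IsInternal Blk)
    (hact : ∀ g g' b, act (g * g') b = act g (act g' b)) (hact1 : ∀ b, act 1 b = b) (hperm : ∀ g b m, m ∈ Blk b → ρ g m ∈ Blk (act g b))
    (x : ι → β) (idx : β → ι) (tr : β → G) (hidx : ∀ i, idx (x i) = i) (hidx_act : ∀ g b, idx (act g b) = idx b) (htr : ∀ b, act (tr b) (x (idx b)) = b)
    (hP : ∀ i g, g ∈ P i ↔ act g (x i) = x i) (hPo : ∀ i, IsOpen (P i : Set G))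
    (hjinj : ∀ i, Injective (j i)) (hjr : ∀ i, LinearMap.range (j i) = Blk (x i)) (hjσ : ∀ (i : ι) (p : P i) (w : W i), j i (σ i p w) = ρ (p : G) (j i w))
    (hσ : ∀ i, (σ i).IsSmooth) :
    ∃ e : (Representation.directSum fun i => cIndRep (P i) (σ i)).Equiv ρ,
      (∀ (i : ι) (F : CInd (P i) (σ i)), (∀ y : G, y ∉ P i → (cIndToSmoothInd (P i) (σ i) F).toFun y = 0) →
          e (DirectSum.lof k ι (fun i => CInd (P i) (σ i)) i F) = j i ((cIndToSmoothInd (P i) (σ i) F).toFun 1)) ∧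
      ∀ (m : M) (i : ι) (g : G), j i ((cIndToSmoothInd (P i) (σ i) (e.symm m i)).toFun g) =
        (((LinearEquiv.ofBijective (DirectSum.coeLinearMap Blk) h).symm (ρ g m)) (x i) : M) := by
  classical
  -- the summand maps and the unit vectors
  choose T hT using fun i => exists_intertwiningMap_cIndRep_of_chart (ρ := ρ) (P i) (σ i) (hPo i) (j i) (hjσ i)
  choose u hu hu0 using fun i => exists_unitVector_linearMap (P i) (σ i) (hPo i) (hσ i)
  -- the sum map `Ts`, `Ts [F]_i = T i F`
  obtain ⟨eHom, heHom⟩ := exists_linearEquiv_intertwiningMap_directSum_pi (fun i => cIndRep (P i) (σ i)) ρ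
  set Ts : (Representation.directSum fun i => cIndRep (P i) (σ i)).IntertwiningMap ρ := eHom.symm T with hTs
  have hTs_lof : ∀ (i : ι) (F : CInd (P i) (σ i)), Ts (DirectSum.lof k ι (fun i => CInd (P i) (σ i)) i F) = T i F := by
    intro i F
    rw [← heHom Ts i F, hTs, LinearEquiv.apply_symm_apply]
  have hTs_unit : ∀ (i : ι) (y : G) (w : W i), Ts (DirectSum.lof k ι (fun i => CInd (P i) (σ i)) i (cIndRep (P i) (σ i) y (u i w))) = ρ y (j i w) := by
    intro i y w
    rw [hTs_lof, intertwiningMap_cIndRep_unitVector (hu i) (hu0 i) (hT i)]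
  -- the block decomposition
  set e₀ := LinearEquiv.ofBijective (DirectSum.coeLinearMap Blk) h with he₀
  have hjmem : ∀ (i : ι) (w : W i), j i w ∈ Blk (x i) := fun i w => by rw [← hjr i]; exact LinearMap.mem_range_self _ w
  -- SURJECTIVITY: every block is hit
  have hsurj : Surjective Ts := by
    have hrange : ∀ b, Blk b ≤ LinearMap.range Ts.toLinearMap := by
      intro b m hm
      have hm' : ρ (tr b)⁻¹ m ∈ Blk (x (idx b)) := by
        have h1 := hperm (tr b)⁻¹ b m hm
        rwa [← congrArg (act (tr b)⁻¹) (htr b), ← hact, inv_mul_cancel, hact1] at h1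
      rw [← hjr (idx b)] at hm'
      obtain ⟨w, hw⟩ := hm'
      refine ⟨DirectSum.lof k ι (fun i => CInd (P i) (σ i)) (idx b) (cIndRep (P (idx b)) (σ (idx b)) (tr b) (u (idx b) w)), ?_⟩
      rw [IntertwiningMap.toLinearMap_apply, hTs_unit, hw, ← Module.End.mul_apply, ← map_mul, mul_inv_cancel, map_one, Module.End.one_apply]
    have htop : LinearMap.range Ts.toLinearMap = ⊤ := by
      rw [eq_top_iff, ← h.submodule_iSup_eq_top, iSup_le_iff]
      exact hrange
    exact LinearMap.range_eq_top.1 htop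
  -- THE COEFFICIENT IDENTITY `j i (c i g) = pr_{x i} (ρ g (Ts c))`
  have h0fun : ∀ (i : ι) (g : G), (cIndToSmoothInd (P i) (σ i) 0).toFun g = 0 := fun i g => by rw [map_zero]; rfl
  have hcoef : ∀ (c : ⨁ i, CInd (P i) (σ i)) (i : ι) (g : G),
      j i ((cIndToSmoothInd (P i) (σ i) (c i)).toFun g) = ((e₀.symm (ρ g (Ts c))) (x i) : M) := by
    intro c i g
    -- the statement is additive in `c`
    have hadd : ∀ c c' : ⨁ i, CInd (P i) (σ i),
        j i ((cIndToSmoothInd (P i) (σ i) (c i)).toFun g) = ((e₀.symm (ρ g (Ts c))) (x i) : M) →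
        j i ((cIndToSmoothInd (P i) (σ i) (c' i)).toFun g) = ((e₀.symm (ρ g (Ts c'))) (x i) : M) →
        j i ((cIndToSmoothInd (P i) (σ i) ((c + c') i)).toFun g) = ((e₀.symm (ρ g (Ts (c + c')))) (x i) : M) := by
      intro c c' hc hc'
      rw [DirectSum.add_apply, map_add, SmoothInd.toFun_add, Pi.add_apply, map_add, hc, hc', map_add, map_add, map_add, DirectSum.add_apply,
        Submodule.coe_add]
    have hzero : j i ((cIndToSmoothInd (P i) (σ i) ((0 : ⨁ i, CInd (P i) (σ i)) i)).toFun g) = ((e₀.symm (ρ g (Ts 0))) (x i) : M) := by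
      rw [DirectSum.zero_apply, h0fun, map_zero, map_zero, map_zero, map_zero, DirectSum.zero_apply, Submodule.coe_zero]
    -- on a generator `[y • f_w]_{i'}`
    have hgen : ∀ (i' : ι) (y : G) (w : W i'),
        j i ((cIndToSmoothInd (P i) (σ i) ((DirectSum.lof k ι (fun i => CInd (P i) (σ i)) i' (cIndRep (P i') (σ i') y (u i' w))) i)).toFun g) =
          ((e₀.symm (ρ g (Ts (DirectSum.lof k ι (fun i => CInd (P i) (σ i)) i' (cIndRep (P i') (σ i') y (u i' w)))))) (x i) : M) := by
      intro i' y w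
      rw [hTs_unit, ← Module.End.mul_apply, ← map_mul]
      have hmem : ρ (g * y) (j i' w) ∈ Blk (act (g * y) (x i')) := hperm _ _ _ (hjmem i' w)
      by_cases hfix : act (g * y) (x i') = x i
      · -- then `i' = i` and `g y ∈ P i`
        have hii : i' = i := by rw [← hidx i', ← hidx_act (g * y) (x i'), hfix, hidx]
        subst hii
        have hgy : g * y ∈ P i' := (hP i' _).2 hfix
        rw [hfix] at hmem
        rw [he₀, h.ofBijective_coeLinearMap_of_mem hmem, DirectSum.lof_apply, toFun_cIndToSmoothInd_cIndRep, hu i' w _ hgy, hjσ]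
      · rw [he₀, h.ofBijective_coeLinearMap_of_mem_ne hfix hmem, Submodule.coe_zero]
        by_cases hii : i' = i
        · subst hii
          have hgy : g * y ∉ P i' := fun hgy => hfix ((hP i' _).1 hgy)
          rw [DirectSum.lof_apply, toFun_cIndToSmoothInd_cIndRep, hu0 i' w _ hgy, map_zero]
        · rw [DirectSum.lof_eq_of, DirectSum.of_eq_of_ne i' i _ (Ne.symm hii), h0fun, map_zero]
    -- on `[F]_{i'}` by GENERATION
    have hlof : ∀ (i' : ι) (F : CInd (P i') (σ i')),
        j i ((cIndToSmoothInd (P i) (σ i) ((DirectSum.lof k ι (fun i => CInd (P i) (σ i)) i' F) i)).toFun g) =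
          ((e₀.symm (ρ g (Ts (DirectSum.lof k ι (fun i => CInd (P i) (σ i)) i' F)))) (x i) : M) := by
      intro i' F
      obtain ⟨s, U, hU0, hU, hF⟩ := exists_finset_eq_sum_cIndRep_indicator (P i') (σ i') (hPo i') F
      -- each `U y` is the unit vector of `F (y⁻¹)`
      have hUu : ∀ y ∈ s, U y = u i' ((cIndToSmoothInd (P i') (σ i') F).toFun y⁻¹) := by
        intro y hy
        rw [eq_unitVector_of_forall_toFun_eq_zero (hu i') (hu0 i') (U y) (hU0 y hy), hU y hy 1 (P i').one_mem]
        exact congrArg (u i') (LinearMap.congr_fun (show σ i' ⟨1, (P i').one_mem⟩ = 1 from map_one (σ i')) _)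
      rw [hF, map_sum]
      clear hF
      induction s using Finset.induction_on with
      | empty => rw [Finset.sum_empty]; exact hzero
      | insert a s ha ih =>
        rw [Finset.sum_insert ha]
        refine hadd _ _ ?_ (ih (fun y hy => hU0 y (Finset.mem_insert_of_mem hy)) (fun y hy => hU y (Finset.mem_insert_of_mem hy))
          (fun y hy => hUu y (Finset.mem_insert_of_mem hy)))
        rw [hUu a (Finset.mem_insert_self a s)]
        exact hgen i' a _
    induction c using DirectSum.induction_on with
    | zero => exact hzero
    | of i' F => rw [← DirectSum.lof_eq_of k]; exact hlof i' F
    | add c c' hc hc' => exact hadd c c' hc hc'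
  -- INJECTIVITY
  have hinj : Injective Ts := by
    refine (injective_iff_map_eq_zero Ts).2 fun c hc => ?_
    refine DFinsupp.ext fun i => ?_
    rw [DirectSum.zero_apply]
    apply cIndToSmoothInd_injective
    rw [map_zero]
    refine SmoothInd.ext (funext fun g => ?_)
    have hg := hcoef c i g
    rw [hc, map_zero, map_zero, DirectSum.zero_apply, Submodule.coe_zero, ← map_zero (j i)] at hg
    rw [hjinj i hg]
    rfl
  -- the equivalence
  let eL : (⨁ i, CInd (P i) (σ i)) ≃ₗ[k] M := LinearEquiv.ofBijective Ts.toLinearMap ⟨hinj, hsurj⟩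
  have heL : ∀ c, eL c = Ts c := fun c => rfl
  let e : (Representation.directSum fun i => cIndRep (P i) (σ i)).Equiv ρ :=
    Representation.Equiv.mk eL fun g => LinearMap.ext fun c => by
      change eL (Representation.directSum (fun i => cIndRep (P i) (σ i)) g c) = ρ g (eL c)
      rw [heL, heL, Ts.isIntertwining]
  have he : ∀ c, e c = Ts c := fun c => rfl
  have hesymm : ∀ m, Ts (e.symm m) = m := fun m => by rw [← he]; exact e.apply_symm_apply m
  refine ⟨e, fun i F hF => by rw [he, hTs_lof, hT i F hF], fun m i g => ?_⟩
  rw [hcoef (e.symm m) i g, hesymm]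

end Blocks

/-! ## §3 Transport of intertwining maps; §4 the dimension count -/

section Hom

variable {k G M V : Type*} [CommRing k] [Group G] [TopologicalSpace G] [IsTopologicalGroup G] [AddCommGroup M] [Module k M] [AddCommGroup V] [Module k V]
  {ρ : Representation k G M} {β : Type*} {Blk : β → Submodule k M} {act : G → β → β}
  {ι : Type*} {W : ι → Type*} [∀ i, AddCommGroup (W i)] [∀ i, Module k (W i)]
  {P : ι → Subgroup G} {σ : ∀ i, Representation k (P i) (W i)} {j : ∀ i, W i →ₗ[k] M}

/-- **`Hom_G(M, π) ≃ₗ[k] Hom_G(⊕_i c-Ind_{P_i}^G σ_i, π)`** for every representation `π` (pre-composition with the equivalence of §2 and its inverse; the `CommRing` form of ★ `IntertwiningMap.congrLeft` of `Semisimple.Multiplicity`, which is stated over a field).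
[cite: SchneiderStuhler1997, Ch. III §4] [cite: Brown1982, III §5] -/
theorem nonempty_intertwiningMap_linearEquiv_of_blocks [DecidableEq ι] [DecidableEq β] (h : DirectSum.IsInternal Blk)
    (hact : ∀ g g' b, act (g * g') b = act g (act g' b)) (hact1 : ∀ b, act 1 b = b) (hperm : ∀ g b m, m ∈ Blk b → ρ g m ∈ Blk (act g b))
    (x : ι → β) (idx : β → ι) (tr : β → G) (hidx : ∀ i, idx (x i) = i) (hidx_act : ∀ g b, idx (act g b) = idx b) (htr : ∀ b, act (tr b) (x (idx b)) = b)
    (hP : ∀ i g, g ∈ P i ↔ act g (x i) = x i) (hPo : ∀ i, IsOpen (P i : Set G))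
    (hjinj : ∀ i, Injective (j i)) (hjr : ∀ i, LinearMap.range (j i) = Blk (x i)) (hjσ : ∀ (i : ι) (p : P i) (w : W i), j i (σ i p w) = ρ (p : G) (j i w))
    (hσ : ∀ i, (σ i).IsSmooth) (π : Representation k G V) :
    Nonempty (ρ.IntertwiningMap π ≃ₗ[k] (Representation.directSum fun i => cIndRep (P i) (σ i)).IntertwiningMap π) := by
  obtain ⟨e, -⟩ := exists_equiv_directSum_cIndRep h hact hact1 hperm x idx tr hidx hidx_act htr hP hPo hjinj hjr hjσ hσ
  -- pre-composition with `e` ∕ `e.symm` (the `CommRing` form of ★ `IntertwiningMap.congrLeft`, which is stated over a field)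
  refine ⟨?_⟩
  exact
    { toFun := fun f => f.comp e.toIntertwiningMap
      invFun := fun f => f.comp e.symm.toIntertwiningMap
      map_add' := fun _ _ => rfl
      map_smul' := fun _ _ => rfl
      left_inv := fun f => IntertwiningMap.ext (LinearMap.ext fun m => congrArg f (e.apply_symm_apply m))
      right_inv := fun f => IntertwiningMap.ext (LinearMap.ext fun c => congrArg f (e.symm_apply_apply c)) }

end Hom

section Finrank

variable {k G M V : Type*} [Field k] [Group G] [TopologicalSpace G] [IsTopologicalGroup G] [AddCommGroup M] [Module k M] [AddCommGroup V] [Module k V]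
  {ρ : Representation k G M} {β : Type*} {Blk : β → Submodule k M} {act : G → β → β}
  {ι : Type*} {W : ι → Type*} [∀ i, AddCommGroup (W i)] [∀ i, Module k (W i)]
  {P : ι → Subgroup G} {σ : ∀ i, Representation k (P i) (W i)} {j : ∀ i, W i →ₗ[k] M}

/-- **`finrank k Hom_G(M, π) = Σ_i finrank k Hom_{P_i}(σ_i, π|_{P_i})`** for a block-permutation module with FINITELY many orbits (`k` a field, the local Hom-spaces
finite-dimensional): §2 + ★ 45 §3 (Frobenius reciprocity summand by summand) — the right-hand side of ★ 42 `smoothTrace_epFunction` BY SHAPE.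
[cite: SchneiderStuhler1997, Ch. III §4] [cite: BushnellHenniart2006, §2.5 Proposition] -/
theorem finrank_intertwiningMap_eq_sum_of_blocks [Fintype ι] [DecidableEq ι] [DecidableEq β] (h : DirectSum.IsInternal Blk)
    (hact : ∀ g g' b, act (g * g') b = act g (act g' b)) (hact1 : ∀ b, act 1 b = b) (hperm : ∀ g b m, m ∈ Blk b → ρ g m ∈ Blk (act g b))
    (x : ι → β) (idx : β → ι) (tr : β → G) (hidx : ∀ i, idx (x i) = i) (hidx_act : ∀ g b, idx (act g b) = idx b) (htr : ∀ b, act (tr b) (x (idx b)) = b)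
    (hP : ∀ i g, g ∈ P i ↔ act g (x i) = x i) (hPo : ∀ i, IsOpen (P i : Set G))
    (hjinj : ∀ i, Injective (j i)) (hjr : ∀ i, LinearMap.range (j i) = Blk (x i)) (hjσ : ∀ (i : ι) (p : P i) (w : W i), j i (σ i p w) = ρ (p : G) (j i w))
    (hσ : ∀ i, (σ i).IsSmooth) (π : Representation k G V) [∀ i, FiniteDimensional k ((σ i).IntertwiningMap (π.comp (P i).subtype))] :
    Module.finrank k (ρ.IntertwiningMap π) = ∑ i, Module.finrank k ((σ i).IntertwiningMap (π.comp (P i).subtype)) := by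
  obtain ⟨e⟩ := nonempty_intertwiningMap_linearEquiv_of_blocks h hact hact1 hperm x idx tr hidx hidx_act htr hP hPo hjinj hjr hjσ hσ π
  rw [e.finrank_eq, finrank_intertwiningMap_directSum_cIndRep_eq_sum P σ π hPo hσ]

/-- `Hom_G(M, π)` is finite-dimensional when the orbits are finitely many and the local Hom-spaces are. [cite: SchneiderStuhler1997, Ch. III §4] -/
theorem finiteDimensional_intertwiningMap_of_blocks [Finite ι] [DecidableEq ι] [DecidableEq β] (h : DirectSum.IsInternal Blk)
    (hact : ∀ g g' b, act (g * g') b = act g (act g' b)) (hact1 : ∀ b, act 1 b = b) (hperm : ∀ g b m, m ∈ Blk b → ρ g m ∈ Blk (act g b))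
    (x : ι → β) (idx : β → ι) (tr : β → G) (hidx : ∀ i, idx (x i) = i) (hidx_act : ∀ g b, idx (act g b) = idx b) (htr : ∀ b, act (tr b) (x (idx b)) = b)
    (hP : ∀ i g, g ∈ P i ↔ act g (x i) = x i) (hPo : ∀ i, IsOpen (P i : Set G))
    (hjinj : ∀ i, Injective (j i)) (hjr : ∀ i, LinearMap.range (j i) = Blk (x i)) (hjσ : ∀ (i : ι) (p : P i) (w : W i), j i (σ i p w) = ρ (p : G) (j i w))
    (hσ : ∀ i, (σ i).IsSmooth) (π : Representation k G V) [∀ i, FiniteDimensional k ((σ i).IntertwiningMap (π.comp (P i).subtype))] :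
    FiniteDimensional k (ρ.IntertwiningMap π) := by
  obtain ⟨e⟩ := nonempty_intertwiningMap_linearEquiv_of_blocks h hact hact1 hperm x idx tr hidx hidx_act htr hP hPo hjinj hjr hjσ hσ π
  haveI := finite_intertwiningMap_directSum_cIndRep P σ π hPo hσ
  exact Module.Finite.equiv e.symm

end Finrank

end Representation
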